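import Literature.MathematicalPhysics.QuantumFieldTheory.Dimock2011to13.QED3WalkExpansionInverse
import Literature.MathematicalPhysics.QuantumFieldTheory.Dimock2011to13.QED3OnePointBlockSum
import HarnessLib

/-!
# Dimock, *QED on the 3-torus. II*, §3.2 THEOREM 1 (132)–(135), single-scale member (Remark 3) WITH THE LATTICE
# GEOMETRY AND THE PATH COUNTS CONCRETE: the tree's assembled `dimock_thm1` (existence of `S_{k,Λ}(A)`, the walk expansion,
# the bound (135)) with its distance `d` = the tree's `pathDist` (127), block radius `r = w′h`, one-point sum
# `K = (2∕(1−e^{−cw′s∕2|ι|}))^{|ι|}` ((155)) and path-count constant `ν = 3^{|ι|}` ((132) adjacency) — no abstract geometry left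

statement-level skeleton of published theorems with citation tags; proofs where landed; nothing here is a claim about the Yang–Mills mass gap

**Citation header (reproduction of PUBLISHED work).** J. Dimock, *Quantum electrodynamics on the 3-torus. II*,
arXiv:math-ph/0407063 [Dimock2004QED3TorusII], **§3.2 THEOREM 1** (132)–(135) p.22 L2–21, Remark 3 p.22 L28–30, proof
Parts I and III p.23 L1–40, p.24 L59 – p.25 L12; **§3.1** (126)–(127) p.21 L11–23; of the held arXiv text layer
`paper:arxiv-math-ph_0407063` (`p.NN Lnn` = PDF page ∕ text-layer line).  Writer seat p11
(literature-prover-lit-balaban-p11-g23-0), YM LIT SWEEP item (c) D13 (row C13 «WHERE»; zero weight for the YM-INPRINT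
tokens).  Imports the tree's `QED3WalkExpansionInverse` (`dimock_thm1`) and `QED3OnePointBlockSum` (`one_point_sum_pathDist_const_le`,
`card_filter_le_of_supDist`, `adjcard_le`; via it `QED3ScaledPathMetric`).

**The printed text.** (132) p.22 L2–11: *"`S_{k,Λ}(A,x,y) = Σ_{ω:x→y}S_{k,Λ,ω}(A,x,y)` (132) Here we are summing over paths
`ω` each of which is a sequence of adjacent cubes (blocks) `□_0,…,□_n` from `D`. … the adjacency condition is that
`□_j, □_{j+1}` should touch, possibly only on corners, and including the possibility `□_j = □_{j+1}`.  The notation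
`ω : x → y` means `x ∈ □̃_0`, `y ∈ □̃_n`."*  THEOREM 1 p.22 L12–21: *"… Then `S_{k,Λ}(A,x,y)` exists and has the random walk
expansion (132). We have the bound for each path (134) and the bound for the full propagator
`|S_{k,Λ}(A,x,y)| ≤ O(1)d′(x,y)^{−2}exp(−O(1)d_Λ(x,y))` (135)"*; Remark 3 p.22 L28–30 (`Λ` the full tori: `d_Λ = d`);
p.25 L10–12: *"For the bound on `S_{k,Λ}(A,x,y)` we sum over paths. The factor `(O(1)M_0)^{−n}` is sufficient to control the
sum if `M_0` is sufficiently large."*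

**What is formalized (kernel-checked, zero `sorry`).**  **`dimock_thm1_lattice`**: the tree's `dimock_thm1` (sites `X`,
cubes `Z` with the multiplication operators `H □ = h_□` and local inverses `G □ = S*_□(A)`, (125) `Σ_□h_□² = 1`, (136)
`h_□AS*_□ = h_□`, the link bounds (137) ∕ (143) with profiles `P₀`, `Q`, the block convolution bounds (154) for `(Q,Q)` and
`(P₀,Q)`, `h_□R_{□′} = 0` for non-adjacent cubes, start-cube supports `S₀`, `S₁`) in which the GEOMETRY is concrete:
* `d(u,v) = pathDist (fun _ ↦ w′) (e u) (e v)` (one weight `w′ > 0`, an index map `e : X → ℤ^ι`): `hd0 ∕ hsymm ∕ htri` by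
  `pathDist_nonneg ∕ _comm ∕ _triangle`;
* block centres `e (ctr b) = u₀ + s·idx b` (`idx` injective, `s ≥ 1`) and sites within sup-distance `h` of their block
  centre: `hrad` with `r = w′h`, `hK` with `K = (2∕(1 − e^{−(c∕2)w′s∕|ι|}))^{|ι|}` (`one_point_sum_pathDist_const_le`);
* cubes indexed injectively by `cidx : Z → ℤ^ι`, the adjacency implying `supDist (cidx □) (cidx □′) ≤ 1` (the printed
  *"touch, possibly only on corners, … including `□_j = □_{j+1}`"*), and the start cubes of a site `x` having index within
  `1` of an index `sidx x` (*"`x ∈ □̃_0`"*, `□̃` the concentric triple cube (126)): `hadjcard`, `hS₀card`, `hS₁card` with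
  `ν = 3^{|ι|}` (`adjcard_le`, `card_filter_le_of_supDist`; `= 27` on `ι = Fin 3`);
* *"`M_0` sufficiently large"* = `2·3^{|ι|}·C₁θKe^{2cw′h} ≤ M_0` with these `K`, `r`.
Conclusions as in `dimock_thm1`: every entry series converges, `A·S_{k,Λ}(A) = 1`, and (135)
`‖S_{k,Λ}(A;x,y)‖ ≤ 2·3^{|ι|}·C₀e^{3cw′h}·P₀(x,y)e^{−(c∕2)d(x,y)}`.

**Honest scope.** What REMAINS hypothesis is the printed analytic input: (125), (136), (137) ∕ (143) (LEMMA 2 and Part II),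
(154) ∕ (202)–(203) (`hconv`, `hconv₀`; on `ℤ³` the tree's `hconv_Z3(_boson)`), the operator support facts `h_□R_{□′} = 0`
and `link = 0` off the start cubes (from `supp h_□ ⊂ □̃`, not re-derived here).  Single scale only (Remark 3); the
multiscale THEOREM 1 needs Bałaban's Lemma 2.1 for `K`.  No named facts are introduced.
-/

namespace Literature.MathematicalPhysics.QuantumFieldTheory.Dimock2011to13

namespace QED3TorusII

open Finset Real QED3PathMetric
open RandomWalkExpansion (Kz Gstar Kop)

variable {ι : Type*} [Fintype ι] [DecidableEq ι]
variable {X : Type*} [Fintype X] [DecidableEq X] {E : Type*} [NormedRing E] [NormedAlgebra ℝ E]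
variable {Z : Type*} [Fintype Z] [DecidableEq Z]
variable {B : Type*} [Fintype B] [DecidableEq B]

/-- **THEOREM 1, single-scale member, geometry and path counts concrete.**  See the module docstring: the tree's
`dimock_thm1` with `d := pathDist (fun _ ↦ w′) ∘ e`, `r := w′h`, `K := (2∕(1 − e^{−(c∕2)w′s∕|ι|}))^{|ι|}`, `ν := 3^{|ι|}`, the
hypotheses `hd0`, `hsymm`, `htri`, `hrad`, `hK`, `hadjcard`, `hS₀card`, `hS₁card` DISCHARGED from the lattice data.
[cite: Dimock2004QED3TorusII, §3.2 Thm 1 (132)–(135) p.22 L2–21, Remark 3 p.22 L28–30, proof Parts I and III p.23 L1–40, p.24 L59 – p.25 L12] -/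
theorem dimock_thm1_lattice [CompleteSpace E] {θ c : ℝ} {P₀ Q : X → X → ℝ} {blk : X → B} {ctr : B → X}
    (adj : Z → Z → Prop) [DecidableRel adj]
    (e : X → (ι → ℤ)) (idx : B → (ι → ℤ)) (hidx : Function.Injective idx) (u₀ : ι → ℤ) {s : ℕ} (hs : 1 ≤ s)
    (hctr : ∀ b, e (ctr b) = u₀ + s • idx b) {h : ℕ} (hcentre : ∀ u, supDist (e u) (e (ctr (blk u))) ≤ h)
    (cidx : Z → (ι → ℤ)) (hcidx : Function.Injective cidx)
    (hadj1 : ∀ z z', adj z z' → supDist (cidx z) (cidx z') ≤ 1) (sidx : X → (ι → ℤ))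
    {w' : ℝ} (hw' : 0 < w') (hθ : 0 ≤ θ) (hc : 0 < c) (hQ0 : ∀ u v, 0 ≤ Q u v) (hP₀0 : ∀ u v, 0 ≤ P₀ u v)
    (hconv : ∀ (b : B) (u v : X),
      ∑ y ∈ univ.filter (fun u => blk u = b), (1 : ℝ) * (Q u y * Q y v) ≤ θ * Q u v)
    (hconv₀ : ∀ (b : B) (u v : X),
      ∑ y ∈ univ.filter (fun u => blk u = b), (1 : ℝ) * (P₀ u y * Q y v) ≤ θ * P₀ u v)
    (A : Matrix X X E) (H G : Z → Matrix X X E)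
    (h125 : ∑ z, H z * H z = 1) (h136 : ∀ z, H z * A * G z = H z)
    {C₀ C₁ M₀ : ℝ} (hC₀ : 0 ≤ C₀) (hC₁ : 0 ≤ C₁) (hM₀ : 0 < M₀)
    (h0 : ∀ z u v, ‖link0 H G z u v‖
      ≤ C₀ * (P₀ u v * Real.exp (-(c * pathDist (fun _ => w') (e u) (e v)))))
    (hR : ∀ z u v, ‖linkR A H G z u v‖
      ≤ C₁ / M₀ * (Q u v * Real.exp (-(c * pathDist (fun _ => w') (e u) (e v)))))
    (hadj : ∀ z z', ¬ adj z z' → H z * Kz A H z' = 0)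
    (S₀ : X → Finset Z) (hS₀ : ∀ x, ∀ z ∉ S₀ x, ∀ v, link0 H G z x v = 0)
    (hS₀near : ∀ x, ∀ z ∈ S₀ x, supDist (sidx x) (cidx z) ≤ 1)
    (S₁ : X → Finset Z) (hS₁ : ∀ x, ∀ z ∉ S₁ x, ∀ v, linkR A H G z x v = 0)
    (hS₁near : ∀ x, ∀ z ∈ S₁ x, supDist (sidx x) (cidx z) ≤ 1)
    (hlarge : 2 * (((3 ^ Fintype.card ι : ℕ) : ℝ) *
        (C₁ * θ * (2 / (1 - Real.exp (-(c / 2 * (w' * s) / Fintype.card ι)))) ^ Fintype.card ι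
          * Real.exp (2 * c * (w' * h)))) ≤ M₀) :
    (∀ x y, Summable fun n => (Gstar H G * Kop A H G ^ n) x y) ∧
    A * walkExpansion A H G = 1 ∧
    ∀ x y, ‖walkExpansion A H G x y‖
      ≤ 2 * ((3 ^ Fintype.card ι : ℕ) : ℝ) * (C₀ * Real.exp (3 * c * (w' * h)))
        * (P₀ x y * Real.exp (-(c / 2) * pathDist (fun _ => w') (e x) (e y))) := by
  have hρ : ∀ u : ι → ℤ, (0 : ℝ) ≤ (fun _ : ι → ℤ => w') u := fun _ => hw'.le
  -- the path-count constant `ν = 3^{|ι|}`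
  have hS₀card : ∀ x, (S₀ x).card ≤ 3 ^ Fintype.card ι := by
    intro x
    have h1 : (S₀ x).card ≤ (univ.filter fun z => supDist (sidx x) (cidx z) ≤ 1).card :=
      card_le_card fun z hz => mem_filter.2 ⟨mem_univ _, hS₀near x z hz⟩
    have h2 := card_filter_le_of_supDist cidx hcidx (fun z => supDist (sidx x) (cidx z) ≤ 1) (sidx x) 1
      (fun z hz => hz)
    have h3 : (2 * 1 + 1) ^ Fintype.card ι = 3 ^ Fintype.card ι := by norm_num
    omega
  have hS₁card : ∀ x, (S₁ x).card ≤ 3 ^ Fintype.card ι := by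
    intro x
    have h1 : (S₁ x).card ≤ (univ.filter fun z => supDist (sidx x) (cidx z) ≤ 1).card :=
      card_le_card fun z hz => mem_filter.2 ⟨mem_univ _, hS₁near x z hz⟩
    have h2 := card_filter_le_of_supDist cidx hcidx (fun z => supDist (sidx x) (cidx z) ≤ 1) (sidx x) 1
      (fun z hz => hz)
    have h3 : (2 * 1 + 1) ^ Fintype.card ι = 3 ^ Fintype.card ι := by norm_num
    omega
  have hadjcard : ∀ z, (univ.filter fun z' => adj z z').card ≤ 3 ^ Fintype.card ι :=
    fun z => adjcard_le cidx hcidx adj hadj1 z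
  exact dimock_thm1 (adj := adj) (d := fun u v => pathDist (fun _ => w') (e u) (e v)) (ctr := ctr)
    (r := w' * h) hθ hc.le hQ0 hP₀0 hconv hconv₀
    (fun u v => pathDist_nonneg hρ _ _) (fun u v => pathDist_comm hρ _ _)
    (fun u v t => pathDist_triangle hρ _ _ _)
    (fun u => by
      show pathDist (fun _ => w') (e u) (e (ctr (blk u))) ≤ w' * h
      rw [pathDist_const hw'.le]
      exact mul_le_mul_of_nonneg_left (by exact_mod_cast hcentre u) hw'.le)
    (fun b => by
      show ∑ b', Real.exp (-(c / 2) * pathDist (fun _ => w') (e (ctr b)) (e (ctr b')))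
          ≤ (2 / (1 - Real.exp (-(c / 2 * (w' * s) / Fintype.card ι)))) ^ Fintype.card ι
      simp_rw [hctr]
      exact one_point_sum_pathDist_const_le idx hidx u₀ hs (half_pos hc) hw' b)
    A H G h125 h136 hC₀ hC₁ hM₀ h0 hR hadj hadjcard S₀ hS₀ hS₀card S₁ hS₁ hS₁card hlarge

end QED3TorusII

end Literature.MathematicalPhysics.QuantumFieldTheory.Dimock2011to13
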